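import Mathlib.RingTheory.Polynomial.UniqueFactorization
import Mathlib.RingTheory.Localization.Integral
import Mathlib.RingTheory.Localization.FractionRing
import Mathlib.Algebra.MvPolynomial.NoZeroDivisors
import Mathlib.FieldTheory.IsAlgClosed.AlgebraicClosure
import Literature.Barriers.Schanuel.AxiomsDoNotForceSchanuel
import HarnessLib

/-!
# Barrier `AxiomsDoNotForceSchanuel`: generic zeros of admissible relations (Bays–Kirby 2018, §9.2)

Companion of `Literature/Barriers/Schanuel/AxiomsDoNotForceSchanuel.lean` and of its proof file
`AxiomsDoNotForceSchanuelProofs.lean` (which reduces the barrier's named fact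
`Literature.Barriers.Schanuel.baysKirby2018_modelsWithoutSchanuel` to Bays–Kirby's construction of
the model `𝕄(F_base)` over a finitely generated partial exponential field with standard kernel,
Thm 1.7 + Thm 8.2 — an explicit hypothesis of
`Literature.Barriers.Schanuel.baysKirby2018_modelsWithoutSchanuel_of_softModels` — by building the
§9.2 base inside `ℂ`). M. Bays, J. Kirby,
*Pseudo-exponential maps, variants, and quasiminimality*, Algebra & Number Theory 12 (2018)
493–549 = arXiv:1512.04262, §9.2: "we choose an irreducible polynomial `P(x, y) ∈ ℤ[x, y]` and
take `(ε, τ)` to be a generic zero of the polynomial `P(x, y)`. (We assume that `P` is such that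
neither `ε` nor `τ` is zero.)", with the replaced axiom scheme "stating that `exp(1)` and `τ` are
transcendental, that `P(exp(1), τ) = 0` …".

This file settles the FAITHFULNESS of the rendering `IsAdmissibleRelation P` (irreducible,
positive degree in each variable) of that hypothesis: it is *equivalent* to "irreducible `P`
admitting, in some field of characteristic zero, a zero `(ε, τ)` with both coordinates
transcendental over `ℚ`" (`isAdmissibleRelation_iff_exists_transcendental_zero`) — exactly the
`P` for which Bays–Kirby's hypothesis and their replaced axiom scheme are jointly consistent. The
direction "⇒" is realised by the honest *generic* zero: the function field `Frac(ℤ[x, y]/(P))` of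
the curve, in which `R(ε, τ) = 0 ↔ P ∣ R` (`IsAdmissibleRelation.exists_genericZero`); the
direction "⇐" (`degreeOf_pos_of_transcendental_zero`) complements the tree's
`Literature.NumberTheory.Transcendental.PlaneCurve.transcendental_of_aeval_eq_zero`
(`PlaneCurveTranscendence.lean`: over an irreducible `P` with `deg_x P > 0`, a zero with `x₀`
transcendental has `x₁` transcendental), which goes the other way.

## Contents (all proved)

* `exists_toMvPolynomial_of_vars_subset`, `degreeOf_toMvPolynomial_of_ne` — one-variable
  polynomials inside `ℤ[σ]` (no survivor at this generality in the tree or Mathlib).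
* `degreeOf_pos_of_transcendental_zero`, `isAdmissibleRelation_of_transcendental_zero` — a zero
  of `P ≠ 0` with both coordinates transcendental forces positive degree in each variable.
* `IsAdmissibleRelation.exists_genericZero` — the generic zero in `Frac(ℤ[x, y]/(P))`
  (`P` prime in the UFD `ℤ[x, y]`; `P` divides no non-zero one-variable polynomial, so `ℤ` embeds,
  the characteristic is zero, and both classes `x̄, ȳ` are transcendental), with genericity
  `R(ε, τ) = 0 ↔ P ∣ R`.
* `isAdmissibleRelation_iff_exists_transcendental_zero` — the equivalence.
* `IsAdmissibleRelation.exists_transcendental_zero_isAlgClosed` — the zero inside an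
  algebraically closed field of characteristic zero (an algebraic closure), with no appeal to a
  pre-existing transcendental element of the ambient field.

## Notes

* All fields produced are in `Type`, as in the catalogue fact; `ℤ`-algebra structures on a ring
  coincide (`int_algebra_subsingleton`), and the proofs pin the canonical one where a localisation
  or an algebraic closure offers another.

## References

* M. Bays, J. Kirby, *Pseudo-exponential maps, variants, and quasiminimality*, Algebra & Number
  Theory 12 (2018) 493–549, arXiv:1512.04262: §9.2 (p. 28), Thm 9.1.
-/

noncomputable section

open Cardinal MvPolynomial
open FirstOrder

namespace Literature.Barriers.Schanuel

open Literature.ModelTheory.ExponentialFields Literature.NumberTheory.Transcendental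

/-! ### Polynomials in one of the two variables -/

section OneVariable

variable {R : Type*} [CommRing R]

/-- A polynomial in `ℤ[x, y]` not involving the variable `i` is a one-variable polynomial in the
other variable `j`. [folklore] -/
theorem exists_toMvPolynomial_of_vars_subset {σ : Type*} (P : MvPolynomial σ ℤ) (j : σ)
    (h : (↑P.vars : Set σ) ⊆ {j}) : ∃ p : Polynomial ℤ, p.toMvPolynomial j = P := by
  obtain ⟨q, hq⟩ := exists_rename_eq_of_vars_subset_range P (fun _ : Unit => j)
    (fun _ _ _ => Subsingleton.elim _ _) (by simpa using h)
  refine ⟨MvPolynomial.uniqueAlgEquiv ℤ Unit q, ?_⟩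
  rw [Polynomial.toMvPolynomial_eq_rename_comp, AlgHom.comp_apply]
  change rename (fun _ => j) ((uniqueAlgEquiv ℤ Unit).symm (uniqueAlgEquiv ℤ Unit q)) = P
  rw [AlgEquiv.symm_apply_apply, hq]

/-- The degree in `j ≠ i` of a polynomial in the variable `i` alone is `0`. [folklore] -/
theorem degreeOf_toMvPolynomial_of_ne {σ : Type*} {i j : σ} (h : j ≠ i) (p : Polynomial ℤ) :
    degreeOf j (p.toMvPolynomial i : MvPolynomial σ ℤ) = 0 := by
  classical
  by_contra h0
  have hmem : j ∈ (p.toMvPolynomial i : MvPolynomial σ ℤ).vars :=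
    mem_vars_iff_degreeOf_ne_zero.mpr h0
  rw [Polynomial.toMvPolynomial_eq_rename_comp, AlgHom.comp_apply] at hmem
  replace hmem : j ∈ (rename (fun _ => i) ((uniqueAlgEquiv ℤ Unit).symm p)).vars := hmem
  have := vars_rename (fun _ : Unit => i) _ hmem
  simp only [Finset.mem_image] at this
  obtain ⟨_, _, rfl⟩ := this
  exact h rfl

end OneVariable

/-! ### Generic zeros of admissible relations (the hypothesis of §9.2) -/

section GenericZero

/-- **Zeros with transcendental coordinates force positive bidegree.** If `P ≠ 0` vanishes at a
point `(ε, τ)` of a field of characteristic zero with `ε` and `τ` transcendental over `ℚ`, then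
`P` has positive degree in each variable. (So the replaced axiom scheme of Bays–Kirby §9.2 —
"`exp(1)` and `τ` are transcendental, `P(exp(1), τ) = 0`" — is consistent only for `P` of positive
bidegree.) [cite: BaysKirby2018ANT, §9.2] -/
theorem degreeOf_pos_of_transcendental_zero {Ω : Type*} [Field Ω] [CharZero Ω]
    {P : MvPolynomial (Fin 2) ℤ} (hP : P ≠ 0) {ε τ : Ω} (hε : Transcendental ℚ ε)
    (hτ : Transcendental ℚ τ) (h : MvPolynomial.aeval ![ε, τ] P = 0) :
    0 < P.degreeOf 0 ∧ 0 < P.degreeOf 1 := by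
  -- if `P` misses the variable `i`, it is a nonzero one-variable polynomial in `j` killing `v j`
  have key : ∀ i j : Fin 2, i ≠ j → (∀ k : Fin 2, k = i ∨ k = j) →
      Transcendental ℚ (![ε, τ] j) → 0 < P.degreeOf i := by
    intro i j hij hcover hj
    rw [pos_iff_ne_zero]
    intro h0
    have hvars : (↑P.vars : Set (Fin 2)) ⊆ {j} := by
      intro k hk
      rcases hcover k with rfl | rfl
      · exact absurd h0 (mem_vars_iff_degreeOf_ne_zero.mp hk)
      · rfl
    obtain ⟨p, rfl⟩ := exists_toMvPolynomial_of_vars_subset P j hvars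
    have hp0 : p ≠ 0 := by rintro rfl; exact hP (map_zero _)
    rw [aeval_toMvPolynomial] at h
    have halg : IsAlgebraic ℤ (![ε, τ] j) := ⟨p, hp0, h⟩
    rw [IsFractionRing.isAlgebraic_iff ℤ ℚ Ω] at halg
    exact hj halg
  refine ⟨key 0 1 zero_ne_one (fun k => ?_) (by simpa using hτ),
    key 1 0 one_ne_zero (fun k => ?_) (by simpa using hε)⟩
  · fin_cases k <;> simp
  · fin_cases k <;> simp

/-- Hence an irreducible `P ∈ ℤ[x, y]` with a zero whose coordinates are transcendental is an
admissible relation. [cite: BaysKirby2018ANT, §9.2] -/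
theorem isAdmissibleRelation_of_transcendental_zero {Ω : Type*} [Field Ω] [CharZero Ω]
    {P : MvPolynomial (Fin 2) ℤ} (hP : Irreducible P) {ε τ : Ω} (hε : Transcendental ℚ ε)
    (hτ : Transcendental ℚ τ) (h : MvPolynomial.aeval ![ε, τ] P = 0) :
    IsAdmissibleRelation P :=
  ⟨hP, degreeOf_pos_of_transcendental_zero hP.ne_zero hε hτ h⟩

/-- **Generic zeros of admissible relations** (Bays–Kirby §9.2: "we choose an irreducible
polynomial `P(x, y) ∈ ℤ[x, y]` and take `(ε, τ)` to be a generic zero of the polynomial `P(x, y)`.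
(We assume that `P` is such that neither `ε` nor `τ` is zero.)"). For an admissible `P` the
function field `Ω = Frac(ℤ[x, y]/(P))` of the curve `P = 0` is a field of characteristic zero
containing a *generic* zero `(ε, τ)` of `P` — a polynomial `R ∈ ℤ[x, y]` vanishes at `(ε, τ)` iff
`P ∣ R` — and both coordinates are transcendental over `ℚ` (in particular non-zero), as the
replaced axiom scheme of §9.2 demands. [cite: BaysKirby2018ANT, §9.2] -/
theorem IsAdmissibleRelation.exists_genericZero {P : MvPolynomial (Fin 2) ℤ}
    (hP : IsAdmissibleRelation P) :
    ∃ (Ω : Type) (_ : Field Ω) (_ : CharZero Ω) (ε τ : Ω),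
      Transcendental ℚ ε ∧ Transcendental ℚ τ ∧ MvPolynomial.aeval ![ε, τ] P = 0 ∧
      ∀ R : MvPolynomial (Fin 2) ℤ, MvPolynomial.aeval ![ε, τ] R = 0 ↔ P ∣ R := by
  classical
  obtain ⟨hirr, hdeg0, hdeg1⟩ := hP
  have hprime : Prime P := hirr.prime
  -- the coordinate ring `D = ℤ[x, y]/(P)` is a domain
  set I : Ideal (MvPolynomial (Fin 2) ℤ) := Ideal.span {P} with hI
  haveI hIprime : I.IsPrime := (Ideal.span_singleton_prime hprime.ne_zero).mpr hprime
  set D := MvPolynomial (Fin 2) ℤ ⧸ I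
  haveI : IsDomain D := (Ideal.Quotient.isDomain_iff_prime I).mpr hIprime
  -- key degree fact: `P` divides no nonzero polynomial in one variable
  have hndvd : ∀ (i j : Fin 2), j ≠ i → 0 < P.degreeOf j → ∀ p : Polynomial ℤ, p ≠ 0 →
      ¬ P ∣ (p.toMvPolynomial i : MvPolynomial (Fin 2) ℤ) := by
    intro i j hji hdeg p hp0 ⟨Q, hQ⟩
    have hR0 : (p.toMvPolynomial i : MvPolynomial (Fin 2) ℤ) ≠ 0 := by
      intro h0
      exact hp0 (Polynomial.toMvPolynomial_injective i (by rw [h0, map_zero]))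
    have hQ0 : Q ≠ 0 := by rintro rfl; rw [mul_zero] at hQ; exact hR0 hQ
    have h1 := degreeOf_toMvPolynomial_of_ne (σ := Fin 2) hji p
    rw [hQ, degreeOf_mul_eq hprime.ne_zero hQ0] at h1
    omega
  -- `ℤ → D` is injective, so `D` and its fraction field have characteristic zero
  have hinjZ : ∀ n : ℤ, (Ideal.Quotient.mk I (C n) : D) = 0 → n = 0 := by
    intro n hn
    by_contra hn0
    rw [Ideal.Quotient.eq_zero_iff_mem, hI, Ideal.mem_span_singleton] at hn
    refine hndvd 1 0 zero_ne_one hdeg0 (Polynomial.C n) (by simpa using hn0) ?_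
    simpa using hn
  let Ω := FractionRing D
  -- use the canonical `ℤ`-algebra structure of the ring `Ω` (all such structures coincide)
  letI : Algebra ℤ Ω := Ring.toIntAlgebra Ω
  have hinjD : Function.Injective (algebraMap D Ω) := IsFractionRing.injective D Ω
  haveI : CharZero Ω := by
    refine charZero_of_inj_zero fun n hn => ?_
    have h1 : (algebraMap D Ω) (Ideal.Quotient.mk I (C (n : ℤ))) = (n : Ω) := by simp
    rw [← h1, map_eq_zero_iff _ hinjD] at hn
    exact_mod_cast hinjZ n hn
  -- the generic point
  let ε : Ω := algebraMap D Ω (Ideal.Quotient.mk I (X 0))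
  let τ : Ω := algebraMap D Ω (Ideal.Quotient.mk I (X 1))
  have heval : ∀ R : MvPolynomial (Fin 2) ℤ,
      MvPolynomial.aeval ![ε, τ] R = algebraMap D Ω (Ideal.Quotient.mk I R) := by
    intro R
    have hhom : (MvPolynomial.aeval ![ε, τ] : MvPolynomial (Fin 2) ℤ →ₐ[ℤ] Ω).toRingHom =
        (algebraMap D Ω).comp (Ideal.Quotient.mk I) := by
      refine MvPolynomial.ringHom_ext (fun r => by simp) (fun i => ?_)
      fin_cases i <;> simp [ε, τ]
    exact congrArg (fun f : MvPolynomial (Fin 2) ℤ →+* Ω => f R) hhom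
  have hgen : ∀ R : MvPolynomial (Fin 2) ℤ, MvPolynomial.aeval ![ε, τ] R = 0 ↔ P ∣ R := by
    intro R
    rw [heval, map_eq_zero_iff _ hinjD, Ideal.Quotient.eq_zero_iff_mem, hI,
      Ideal.mem_span_singleton]
  -- transcendence of the coordinates
  have htrans : ∀ (i j : Fin 2), j ≠ i → 0 < P.degreeOf j → Transcendental ℚ (![ε, τ] i) := by
    intro i j hji hdeg
    have hZ : Transcendental ℤ (![ε, τ] i) := by
      rw [transcendental_iff]
      intro p hp
      by_contra hp0
      refine hndvd i j hji hdeg p hp0 ((hgen _).mp ?_)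
      rwa [aeval_toMvPolynomial]
    intro halg
    rw [← IsFractionRing.isAlgebraic_iff ℤ ℚ Ω] at halg
    exact hZ halg
  refine ⟨Ω, inferInstance, inferInstance, ε, τ, ?_, ?_, (hgen P).mpr dvd_rfl, hgen⟩
  · simpa using htrans 0 1 one_ne_zero hdeg1
  · simpa using htrans 1 0 zero_ne_one hdeg0

/-- **`IsAdmissibleRelation` is exactly Bays–Kirby's hypothesis as used in §9.2**: `P` is
irreducible in `ℤ[x, y]` and admits, in some field of characteristic zero, a zero `(ε, τ)` with
both coordinates transcendental over `ℚ` (the formal analogues of `e` and `2πi`, which the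
replaced axiom scheme declares transcendental). [cite: BaysKirby2018ANT, §9.2] -/
theorem isAdmissibleRelation_iff_exists_transcendental_zero (P : MvPolynomial (Fin 2) ℤ) :
    IsAdmissibleRelation P ↔ Irreducible P ∧
      ∃ (Ω : Type) (_ : Field Ω) (_ : CharZero Ω) (ε τ : Ω),
        Transcendental ℚ ε ∧ Transcendental ℚ τ ∧ MvPolynomial.aeval ![ε, τ] P = 0 := by
  constructor
  · intro hP
    obtain ⟨Ω, _, _, ε, τ, hε, hτ, h0, -⟩ := hP.exists_genericZero
    exact ⟨hP.1, Ω, _, _, ε, τ, hε, hτ, h0⟩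
  · rintro ⟨hirr, Ω, _, _, ε, τ, hε, hτ, h0⟩
    exact isAdmissibleRelation_of_transcendental_zero hirr hε hτ h0

/-- **A generic zero inside an algebraically closed field.** For an admissible `P` there is an
algebraically closed field `Ω : Type` of characteristic zero (the algebraic closure of the function
field of the curve `P = 0`) with a zero `(ε, τ)` of `P` whose coordinates are transcendental over
`ℚ` — the ambient field in which the §9.2 base `ℚ^{ab}(τ, (ε_m)_m)` (division points of `ε`, roots
of unity) is formed. [cite: BaysKirby2018ANT, §9.2] -/
theorem IsAdmissibleRelation.exists_transcendental_zero_isAlgClosed {P : MvPolynomial (Fin 2) ℤ}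
    (hP : IsAdmissibleRelation P) :
    ∃ (Ω : Type) (_ : Field Ω) (_ : CharZero Ω) (_ : IsAlgClosed Ω) (ε τ : Ω),
      Transcendental ℚ ε ∧ Transcendental ℚ τ ∧ MvPolynomial.aeval ![ε, τ] P = 0 := by
  obtain ⟨Ω₀, _, _, ε₀, τ₀, hε₀, hτ₀, h0, -⟩ := hP.exists_genericZero
  let Ω := AlgebraicClosure Ω₀
  have hinj : Function.Injective (algebraMap Ω₀ Ω) := (algebraMap Ω₀ Ω).injective
  haveI : CharZero Ω := charZero_of_injective_algebraMap hinj
  -- use the canonical `ℤ`-algebra structure of the ring `Ω` (all such structures coincide)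
  letI : Algebra ℤ Ω := Ring.toIntAlgebra Ω
  have htr : ∀ {a : Ω₀}, Transcendental ℚ a → Transcendental ℚ (algebraMap Ω₀ Ω a) :=
    fun ha => (transcendental_algebraMap_iff hinj).mpr ha
  have hε := htr hε₀
  have hτ := htr hτ₀
  have hzero : MvPolynomial.aeval ![algebraMap Ω₀ Ω ε₀, algebraMap Ω₀ Ω τ₀] P = 0 := by
    have h1 := congrArg (algebraMap Ω₀ Ω) h0
    rw [map_zero, MvPolynomial.map_aeval] at h1
    have h2 : (fun i => algebraMap Ω₀ Ω (![ε₀, τ₀] i)) = ![algebraMap Ω₀ Ω ε₀, algebraMap Ω₀ Ω τ₀] := by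
      funext i; fin_cases i <;> rfl
    have h3 : (algebraMap Ω₀ Ω).comp (algebraMap ℤ Ω₀) = algebraMap ℤ Ω := RingHom.ext_int _ _
    rw [h2, h3, MvPolynomial.coe_eval₂Hom, ← MvPolynomial.aeval_def] at h1
    exact h1
  refine ⟨Ω, inferInstance, inferInstance, inferInstance, algebraMap Ω₀ Ω ε₀, algebraMap Ω₀ Ω τ₀,
    ?_, ?_, ?_⟩
  · convert hε
  · convert hτ
  · exact hzero

end GenericZero


end Literature.Barriers.Schanuel

end
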